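import Summits.QuantumFields.BalabanUV.Beta.GAN24.WardResidualParity
import Summits.QuantumFields.BalabanUV.Beta.WilsonWardColourFree

/-!
# `BalabanUV.Beta.GAN24.WSlotParityJunctionLetters` — row G-an2-4, W-slot EXIT (α) (RULING R-lead-g77-1 (2); the OWNER gan24-p1 g33's RULING R-gan24p1-g33-1 (B3)
# «PARITY-JUNCTION», PART 2 = THE PACKAGING the chair gan24-p2 g44 assigned (W-1 ∕ A-1, journal l.49282 ∕ l.49337): **THE ALL-LEVELS WARD KERNEL LAW OF THE
# W-LITERAL WITH ITS RESIDUAL IN VERTEX FORM, ITS PARITY DICTIONARY AND ITS EVEN ∕ ODD HALVES — ONE `∃ Φ Ψ` END FROM THE LETTERS** — the chair's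
# `WardResidualSRecursionAll.exists_kernelLaws_vertexForm` ⨾ his `WardResidualParity.parityOdd_residual_tower` ⨾ `ward_law_parity_split`, glued with no rewriting (his
# hypothesis shapes ARE the exported clauses), the even ∕ odd halves spelled as PART 1 `WSlotParityJunction` spells them (`½ • (W ± sgnK∘trK∘W)`)
# (G-an2-4 FORMAL swarm → CRUX TEAM (2), leaf-01 lineage, gen 71; the yielded `WardResidualTowerParity` §5, REBASED on the chair's file as he asked).

NOT IN PRINT; OUR BOOKKEEPING.  HONEST FRAMING (cell contract, verbatim): «discharging `BetaPertH` makes Bałaban's UV stability UNCONDITIONAL — a real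
constructive-QFT result; it is NOT the continuum limit and NOT the Clay problem.»  HONEST DEPENDENCY (verbatim): «continuum YM on T⁴ ⇐ BetaPertH ∧ nine spine
estimates (0/9 proved); BetaPertH ⇐ (D1) ∧ (D4) ∧ CAP+tail; G-an2-4 gates asym, D1 and NE2/3/4.»  [folklore] composition BY NAME of three theorems of the road-P2 chair
(`exists_kernelLaws_vertexForm`, `parityOdd_residual_tower`, `ward_law_parity_split`); the seventeen LETTER hypotheses (an1's border law both slots every level, an1's mixed
law every level, the level-0 Wilson law, their classes) and the five letter-remainder ROW PARITIES are DISPLAYED exactly as d1-leaf-06's D1 END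
`WardLocusRecursiveLetters.exists_kernelLaws_of_letters` displays them (at the literal of record `RW = RW″ = 0`, `RB = RB″ = 0` and the parities are the chair's
`parityOdd_zero_family(')`).  No cited fact, no `def`, no `def … : Prop`, 0 sorry.  Asserts NO bound, NO rate, NO value of any table; discharges NOTHING of (Q-R) ∕ (LT) ∕
(DIV) ∕ (DL) ∕ «T2Shape» ∕ «T2Drift» ∕ (hW, hWall) ∕ (C); (β) of record untouched; NEVER «G-an2-4 closed» as (CONV-C); NOT D1, NOT BetaPertH, NOT continuum, NOT Clay.

* §1 **`exists_kernelLaws_vertexForm_parity`** (generic `d`, in-block root `toSite r`, any `cΛ cB`, any initial table `T`, pin `cE₂ = Lc^{2(d+1)}`): `∃ Φ Ψ` with the chair's SIX clauses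
  (Ψ) ∕ (Φ₀) ∕ (Φ-STEP) ∕ (class of `Φ j`) ∕ (class of the residual) ∕ (LAW) for the SAME witnesses, AND (P-Ψ) `Ψ` row-parity-odd, AND (P-Φ) the Ward-locus residual tower
  `Φ` row-parity-odd at every level, AND (TAD) the LAW's residual tadpole-null against every co-dressed step resolvent (the class the OWNER's `WSlotParityBlind` proves the
  D1 END blind to), AND (EVEN LAW) `divW (½ • (W⁰_j + sgnK∘trK∘W⁰_j)) y ν y′ = conjV (dM G_j Lc S_j M_j ν y′) (X_y)` — EXACT, no residual — AND (ODD LAW)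
  `divW (½ • (W⁰_j − sgnK∘trK∘W⁰_j)) y ν y′ = vertexOfK G_j Lc (Φ j y) ν y′ + Ψ j y ν y′`, `W⁰ = WrecAt d Lc ρ …`.
* §2 **`exists_kernelLaws_vertexForm_parity_TW_su`**: the same at the Wilson table of record `T_W = (8N²)⁻¹ • wsym22 N` (`SU(N)`, `2 ≤ N`) with the two WILSON
  letters DISCHARGED (`WilsonWardColourFree.hWil_wilson_TW_su ∕ ''`, `RW = RW″ = 0`): only an1's border and mixed letters (with `RB RB″ RM`, classes, parities) remain displayed.
-/

noncomputable section

open Finset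
open scoped BigOperators
open Literature.MathematicalPhysics.QuantumFieldTheory
open Literature.MathematicalPhysics.QuantumFieldTheory.Balaban1983to89
open Literature.MathematicalPhysics.QuantumFieldTheory.Balaban1983to89.Beta
open ExpKernelCalculus (MKer Decays BiLoc VertexFamily comp tadpole)
open KernelWard (divV divW)
open AffineAveraging (Site box toSite)
open OneStepResolventKernel (Fib wsum LocStencil)
open OneStepKernelFamily (KInvStep colH vertexOfK)
open InterLevelTransport (cwsum)
open BalabanStepJetsSucc (mmRead wE wVH)
open SecondOrderResponse (colM vertexOfM dM LocStencilFM)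
open BalabanCompositeJets (LocStencil₂)
open BalabanStepW2 (M2Of wV4 wB2)
open StepJetData (wilsonA)
open WilsonBiStencil (wilsonW₂)
open AveragingHessianKernelsRooted (vhSAt)
open Summit.QuantumFields.BalabanUV.Beta.TameKernelCalculus
open Summit.QuantumFields.BalabanUV.Beta.ChartConjugation (conjV)
open Summit.QuantumFields.BalabanUV.Beta.BorderedHessian (diagK stepScale sgnK)
open Summit.QuantumFields.BalabanUV.Beta.AveragingWardRootedStencils (legInd)
open Summit.QuantumFields.BalabanUV.Beta.AxialDressingRooted (coDressKBmAt)
open Summit.QuantumFields.BalabanUV.Beta.SpineRooted (SpureRecAt M1At T2RecAt WrecAt e3OfK)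
open Summit.QuantumFields.BalabanUV.Beta.KernelWardRelative (gaugeWt)
open Summit.QuantumFields.BalabanUV.Beta.GAN24.WardResidualSRecursionAll (exists_kernelLaws_vertexForm)
open Summit.QuantumFields.BalabanUV.Beta.GAN24.WardResidualParity (parityOdd_residual_tower ward_law_parity_split)
open Summit.QuantumFields.BalabanUV.Beta.SpineRecursiveParity (parityOdd_zero)
open Summit.QuantumFields.BalabanUV.Beta.WilsonWardColourFree (hWil_wilson_TW_su hWil''_wilson_TW_su)
open WilsonVertex2Sym (wsym22)

namespace Summit.QuantumFields.BalabanUV.Beta.GAN24.WSlotParityJunctionLetters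

variable {d Lc : ℕ} [NeZero Lc]

/-- NOT IN PRINT; OUR BOOKKEEPING ([folklore] composition BY NAME of the road-P2 chair's three theorems).  **THE ALL-LEVELS WARD KERNEL LAW OF `WrecAt` WITH THE RESIDUAL
IN VERTEX FORM — WITH ITS PARITY DICTIONARY, THE TADPOLE-NULL CLASS OF THE RESIDUAL, AND THE EXACT EVEN-HALF ∕ ODD-HALF LAWS.**  Hypotheses =
`WardResidualSRecursionAll.exists_kernelLaws_vertexForm` VERBATIM + the five letter-remainder row parities (`hRWp hRW''p hRBp hRB''p hRMp`).  Conclusion: his six clauses for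
the SAME witnesses ∧ (P-Ψ) ∧ (P-Φ) ∧ (TAD) ∧ (EVEN LAW) ∧ (ODD LAW), the halves spelled `½ • (W⁰_j ± sgnK (trK W⁰_j))` slot by slot (PART 1's spelling; the chair's
`ε = ±1` spelling by `one_smul` ∕ `neg_one_smul`). -/
theorem exists_kernelLaws_vertexForm_parity (hLc : 1 ≤ Lc) {r : Fin (d + 1) → ℕ} (hr : r ∈ box (d + 1) Lc) (cΛ cB : ℝ) {cE₂ : ℝ}
    (hcE₂ : cE₂ = (Lc : ℝ) ^ (2 * (d + 1))) (T : Fin 4 → Fin 4 → Fin 4 → Fin 4 → ℝ)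
    {vh₂S : Fin (d + 1) → (Fin (d + 1) → ℤ) → Fin (d + 1) → (Fin (d + 1) → ℤ) → MKer (d + 1) (Fib d)}
    (hB : ∃ C δ : ℝ, 0 < δ ∧ LocStencil₂ vh₂S C δ)
    {mixFF : Fin (d + 1) → (Fin (d + 1) → ℤ) → Fin (d + 1) → (Fin (d + 1) → ℤ) → MKer (d + 1) (Fib d)}
    (hmix : ∃ C δ : ℝ, 0 < δ ∧ LocStencilFM Lc mixFF C δ)
    {RW RW'' : (Fin (d + 1) → ℤ) → Fin (d + 1) → (Fin (d + 1) → ℤ) → MKer (d + 1) (Fib d)} {RB RB'' : ℕ → (Fin (d + 1) → ℤ) → Fin (d + 1) → (Fin (d + 1) → ℤ) → MKer (d + 1) (Fib d)} {RM : ℕ → (Fin (d + 1) → ℤ) → Fin (d + 1) → (Fin (d + 1) → ℤ) → MKer (d + 1) (Fib d)}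
    (hcls0 : ∃ C δ : ℝ, 0 < δ ∧ (∀ Y, LocStencil (RW Y) C δ) ∧ (∀ Y, LocStencil (RW'' Y) C δ) ∧ (∀ Y, LocStencil (RB 0 Y) C δ) ∧
      (∀ Y, LocStencil (RB'' 0 Y) C δ) ∧ (∀ y, VertexFamily (RM 0 y) Lc C δ))
    (hclsS : ∀ j : ℕ, ∃ C δ : ℝ, 0 < δ ∧ (∀ Y, LocStencil (RB (j + 1) Y) C δ) ∧ (∀ Y, LocStencil (RB'' (j + 1) Y) C δ) ∧
      (∀ y, VertexFamily (RM (j + 1) y) Lc C δ))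
    -- the five letter-remainder ROW PARITIES (d1-leaf-06's D1 END displays the same)
    (hRWp : ∀ Y κ u, trK (RW Y κ u) = -sgnK (RW Y κ u)) (hRW''p : ∀ Y κ u, trK (RW'' Y κ u) = -sgnK (RW'' Y κ u))
    (hRBp : ∀ j Y κ u, trK (RB j Y κ u) = -sgnK (RB j Y κ u)) (hRB''p : ∀ j Y κ u, trK (RB'' j Y κ u) = -sgnK (RB'' j Y κ u))
    (hRMp : ∀ j y ρ w, trK (RM j y ρ w) = -sgnK (RM j y ρ w))
    (hWil : ∀ (Y : Fin (d + 1) → ℤ) (κ' : Fin (d + 1)) (u' : Fin (d + 1) → ℤ),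
      (stepScale d Lc 0 * (Lc : ℝ) ^ (d + 1))⁻¹ • ∑ v ∈ box (d + 1) Lc, divV (fun κ u => cE₂ • wilsonW₂ d T κ u κ' u') ((Lc : ℤ) • Y + toSite v) =
        comp (((Lc : ℝ) ^ (d + 1)) • wilsonA d κ' u') (diagK (((1 : ℝ) / 2) • ∑ v ∈ box (d + 1) Lc, legInd (toSite r) ((Lc : ℤ) • Y + toSite v)))
          - comp (diagK (((1 : ℝ) / 2) • ∑ v ∈ box (d + 1) Lc, legInd (toSite r) ((Lc : ℤ) • Y + toSite v))) (((Lc : ℝ) ^ (d + 1)) • wilsonA d κ' u')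
          + RW Y κ' u')
    (hWil'' : ∀ (Y : Fin (d + 1) → ℤ) (κ : Fin (d + 1)) (u : Fin (d + 1) → ℤ),
      (stepScale d Lc 0 * (Lc : ℝ) ^ (d + 1))⁻¹ • ∑ v ∈ box (d + 1) Lc, divV (fun κ' u' => cE₂ • wilsonW₂ d T κ u κ' u') ((Lc : ℤ) • Y + toSite v) =
        comp (((Lc : ℝ) ^ (d + 1)) • wilsonA d κ u) (diagK (((1 : ℝ) / 2) • ∑ v ∈ box (d + 1) Lc, legInd (toSite r) ((Lc : ℤ) • Y + toSite v)))
          - comp (diagK (((1 : ℝ) / 2) • ∑ v ∈ box (d + 1) Lc, legInd (toSite r) ((Lc : ℤ) • Y + toSite v))) (((Lc : ℝ) ^ (d + 1)) • wilsonA d κ u)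
          + RW'' Y κ u)
    (hBord0 : ∀ (Y : Fin (d + 1) → ℤ) (κ' : Fin (d + 1)) (u' : Fin (d + 1) → ℤ),
      (stepScale d Lc 0 * (Lc : ℝ) ^ (d + 1))⁻¹ • ∑ v ∈ box (d + 1) Lc, divV (fun κ u => cB • vh₂S κ u κ' u') ((Lc : ℤ) • Y + toSite v) =
        comp ((-((Lc : ℝ) ^ (d + 1) * (1 / 2) * (Lc : ℝ) ^ (d + 1))) • vhSAt (toSite r) d Lc rfl κ' u') (diagK (((1 : ℝ) / 2) • ∑ v ∈ box (d + 1) Lc, legInd (toSite r) ((Lc : ℤ) • Y + toSite v)))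
          - comp (diagK (((1 : ℝ) / 2) • ∑ v ∈ box (d + 1) Lc, legInd (toSite r) ((Lc : ℤ) • Y + toSite v))) ((-((Lc : ℝ) ^ (d + 1) * (1 / 2) * (Lc : ℝ) ^ (d + 1))) • vhSAt (toSite r) d Lc rfl κ' u')
          + RB 0 Y κ' u')
    (hBord0'' : ∀ (Y : Fin (d + 1) → ℤ) (κ : Fin (d + 1)) (u : Fin (d + 1) → ℤ),
      (stepScale d Lc 0 * (Lc : ℝ) ^ (d + 1))⁻¹ • ∑ v ∈ box (d + 1) Lc, divV (fun κ' u' => cB • vh₂S κ u κ' u') ((Lc : ℤ) • Y + toSite v) =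
        comp ((-((Lc : ℝ) ^ (d + 1) * (1 / 2) * (Lc : ℝ) ^ (d + 1))) • vhSAt (toSite r) d Lc rfl κ u) (diagK (((1 : ℝ) / 2) • ∑ v ∈ box (d + 1) Lc, legInd (toSite r) ((Lc : ℤ) • Y + toSite v)))
          - comp (diagK (((1 : ℝ) / 2) • ∑ v ∈ box (d + 1) Lc, legInd (toSite r) ((Lc : ℤ) • Y + toSite v))) ((-((Lc : ℝ) ^ (d + 1) * (1 / 2) * (Lc : ℝ) ^ (d + 1))) • vhSAt (toSite r) d Lc rfl κ u)
          + RB'' 0 Y κ u)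
    (hBordS : ∀ (j : ℕ) (Y : Fin (d + 1) → ℤ) (κ' : Fin (d + 1)) (u' : Fin (d + 1) → ℤ),
      (stepScale d Lc (j + 1) * (Lc : ℝ) ^ (d + 1))⁻¹ •
          ∑ v ∈ box (d + 1) Lc, divV (fun κ u => (cB * wB2 d Lc (j + 1)) • vh₂S κ u κ' u') ((Lc : ℤ) • Y + toSite v) =
        comp ((-((Lc : ℝ) ^ (d + 1) * (1 / 2) * (Lc : ℝ) ^ (d + 1)) * wVH d Lc (j + 1)) • vhSAt (toSite r) d Lc rfl κ' u') (diagK (((1 : ℝ) / 2) • ∑ v ∈ box (d + 1) Lc, legInd (toSite r) ((Lc : ℤ) • Y + toSite v)))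
          - comp (diagK (((1 : ℝ) / 2) • ∑ v ∈ box (d + 1) Lc, legInd (toSite r) ((Lc : ℤ) • Y + toSite v))) ((-((Lc : ℝ) ^ (d + 1) * (1 / 2) * (Lc : ℝ) ^ (d + 1)) * wVH d Lc (j + 1)) • vhSAt (toSite r) d Lc rfl κ' u')
          + RB (j + 1) Y κ' u')
    (hBordS'' : ∀ (j : ℕ) (Y : Fin (d + 1) → ℤ) (κ : Fin (d + 1)) (u : Fin (d + 1) → ℤ),
      (stepScale d Lc (j + 1) * (Lc : ℝ) ^ (d + 1))⁻¹ •
          ∑ v ∈ box (d + 1) Lc, divV (fun κ' u' => (cB * wB2 d Lc (j + 1)) • vh₂S κ u κ' u') ((Lc : ℤ) • Y + toSite v) =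
        comp ((-((Lc : ℝ) ^ (d + 1) * (1 / 2) * (Lc : ℝ) ^ (d + 1)) * wVH d Lc (j + 1)) • vhSAt (toSite r) d Lc rfl κ u) (diagK (((1 : ℝ) / 2) • ∑ v ∈ box (d + 1) Lc, legInd (toSite r) ((Lc : ℤ) • Y + toSite v)))
          - comp (diagK (((1 : ℝ) / 2) • ∑ v ∈ box (d + 1) Lc, legInd (toSite r) ((Lc : ℤ) • Y + toSite v))) ((-((Lc : ℝ) ^ (d + 1) * (1 / 2) * (Lc : ℝ) ^ (d + 1)) * wVH d Lc (j + 1)) • vhSAt (toSite r) d Lc rfl κ u)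
          + RB'' (j + 1) Y κ u)
    (hM₂ : ∀ (j : ℕ) (y : Fin (d + 1) → ℤ) (ρ' : Fin (d + 1)) (w : Fin (d + 1) → ℤ),
      (stepScale d Lc j * (Lc : ℝ) ^ (d + 1))⁻¹ • ∑ v ∈ box (d + 1) Lc, divV (fun κ u => M2Of d Lc mixFF j κ u ρ' w) ((Lc : ℤ) • y + toSite v) =
        comp (M1At d Lc (toSite r) cΛ j ρ' w) (diagK (((1 : ℝ) / 2) • ∑ v ∈ box (d + 1) Lc, legInd (toSite r) ((Lc : ℤ) • y + toSite v)))
          - comp (diagK (((1 : ℝ) / 2) • ∑ v ∈ box (d + 1) Lc, legInd (toSite r) ((Lc : ℤ) • y + toSite v))) (M1At d Lc (toSite r) cΛ j ρ' w)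
          + RM j y ρ' w) :
    ∃ Φ Ψ : ℕ → (Fin (d + 1) → ℤ) → Fin (d + 1) → (Fin (d + 1) → ℤ) → MKer (d + 1) (Fib d),
      -- (Ψ) the vertex-free part: level-`j` FIRST-ORDER data and letters only (the chair's clause, verbatim)
      (∀ (j : ℕ) (y : Fin (d + 1) → ℤ) (ν : Fin (d + 1)) (y' : Fin (d + 1) → ℤ), Ψ j y ν y' =
        vertexOfM (coDressKBmAt (toSite r) Lc (KInvStep (d := d) Lc j)) Lc (RM j y) ν y'
        + (1 / 2 : ℝ) • (dM (conjV (coDressKBmAt (toSite r) Lc (KInvStep (d := d) Lc j))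
                (diagK (((1 : ℝ) / 2) • ∑ v ∈ box (d + 1) Lc, legInd (toSite r) ((Lc : ℤ) • y + toSite v)))) Lc
              (SpureRecAt d Lc (toSite r) ((Lc : ℝ) ^ (d + 1)) (-((Lc : ℝ) ^ (d + 1) * (1 / 2) * (Lc : ℝ) ^ (d + 1))) cΛ j)
              (M1At d Lc (toSite r) cΛ j) ν y'
          - (stepScale d Lc j * (Lc : ℝ) ^ (d + 1))⁻¹ • (∑ κ, wsum (fun u => ∑' x₂, ∑ κ₂,
              comp (coDressKBmAt (toSite r) Lc (KInvStep (d := d) Lc j))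
                (dM (coDressKBmAt (toSite r) Lc (KInvStep (d := d) Lc j)) Lc
                  (SpureRecAt d Lc (toSite r) ((Lc : ℝ) ^ (d + 1)) (-((Lc : ℝ) ^ (d + 1) * (1 / 2) * (Lc : ℝ) ^ (d + 1))) cΛ j)
                  (M1At d Lc (toSite r) cΛ j) ν y') u x₂ (Sum.inl κ) (Sum.inl κ₂) * gaugeWt Lc y κ₂ x₂)
              (SpureRecAt d Lc (toSite r) ((Lc : ℝ) ^ (d + 1)) (-((Lc : ℝ) ^ (d + 1) * (1 / 2) * (Lc : ℝ) ^ (d + 1))) cΛ j κ)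
            + ∑ ρ', cwsum Lc (fun w => ∑' x₂, ∑ κ₂,
              comp (coDressKBmAt (toSite r) Lc (KInvStep (d := d) Lc j))
                (dM (coDressKBmAt (toSite r) Lc (KInvStep (d := d) Lc j)) Lc
                  (SpureRecAt d Lc (toSite r) ((Lc : ℝ) ^ (d + 1)) (-((Lc : ℝ) ^ (d + 1) * (1 / 2) * (Lc : ℝ) ^ (d + 1))) cΛ j)
                  (M1At d Lc (toSite r) cΛ j) ν y') ((Lc : ℤ) • w) x₂ (Sum.inr ρ') (Sum.inl κ₂) * gaugeWt Lc y κ₂ x₂)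
              (M1At d Lc (toSite r) cΛ j ρ')))) ∧
      -- (Φ₀)
      (Φ 0 = fun y κ u => (1 / 2 : ℝ) • ((RW y κ u + RB 0 y κ u) + (RW'' y κ u + RB'' 0 y κ u))) ∧
      -- (Φ-STEP)
      (∀ j : ℕ, Φ (j + 1) = fun Y κ' u' =>
        ∑ v ∈ box (d + 1) Lc, ((Lc : ℝ) ^ (d + 1) * wE d Lc (j + 1)) •
            e3OfK Lc (coDressKBmAt (toSite r) Lc (KInvStep (d := d) Lc j)) (Φ j ((Lc : ℤ) • Y + toSite v)) κ' u'
          + ((-((Lc : ℝ) ^ (d + 1) * wE d Lc (j + 1))) • ∑ v ∈ box (d + 1) Lc,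
                mmRead Lc (comp (comp (coDressKBmAt (toSite r) Lc (KInvStep (d := d) Lc j)) (Ψ j ((Lc : ℤ) • Y + toSite v) κ' u'))
                  (coDressKBmAt (toSite r) Lc (KInvStep (d := d) Lc j)))
            + (1 / 2 : ℝ) • (RB (j + 1) Y κ' u' + RB'' (j + 1) Y κ' u'))) ∧
      -- per-level classes (NO uniformity in `j`)
      (∀ j : ℕ, ∃ C δ : ℝ, 0 < δ ∧ ∀ y, LocStencil (Φ j y) C δ) ∧
      (∀ j : ℕ, ∃ C δ : ℝ, 0 < δ ∧ ∀ y, VertexFamily (fun ν y' => vertexOfK (coDressKBmAt (toSite r) Lc (KInvStep (d := d) Lc j)) Lc (Φ j y) ν y' + Ψ j y ν y') Lc C δ) ∧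
      -- (LAW)
      (∀ (j : ℕ) (y : Fin (d + 1) → ℤ) (ν : Fin (d + 1)) (y' : Fin (d + 1) → ℤ),
        divW (WrecAt d Lc (toSite r) ((Lc : ℝ) ^ (d + 1)) (-((Lc : ℝ) ^ (d + 1) * (1 / 2) * (Lc : ℝ) ^ (d + 1))) cΛ cE₂ cB T vh₂S mixFF j) y ν y' =
          conjV (dM (coDressKBmAt (toSite r) Lc (KInvStep (d := d) Lc j)) Lc
            (SpureRecAt d Lc (toSite r) ((Lc : ℝ) ^ (d + 1)) (-((Lc : ℝ) ^ (d + 1) * (1 / 2) * (Lc : ℝ) ^ (d + 1))) cΛ j)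
            (M1At d Lc (toSite r) cΛ j) ν y')
          (diagK (((1 : ℝ) / 2) • ∑ v ∈ box (d + 1) Lc, legInd (toSite r) ((Lc : ℤ) • y + toSite v)))
        + (vertexOfK (coDressKBmAt (toSite r) Lc (KInvStep (d := d) Lc j)) Lc (Φ j y) ν y' + Ψ j y ν y')) ∧
      -- (P-Ψ) the first-order data are ROW-PARITY-ODD
      (∀ (j : ℕ) (y : Fin (d + 1) → ℤ) (ν : Fin (d + 1)) (y' : Fin (d + 1) → ℤ), trK (Ψ j y ν y') = -sgnK (Ψ j y ν y')) ∧
      -- (P-Φ) THE WARD-LOCUS RESIDUAL TOWER IS ROW-PARITY-ODD AT EVERY LEVEL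
      (∀ (j : ℕ) (y : Fin (d + 1) → ℤ) (κ : Fin (d + 1)) (u : Fin (d + 1) → ℤ), trK (Φ j y κ u) = -sgnK (Φ j y κ u)) ∧
      -- (TAD) the LAW's residual is tadpole-null against every co-dressed step resolvent (the D1 consumer's (PAR) class; p2 §3 (d))
      (∀ (i j : ℕ) (y : Fin (d + 1) → ℤ) (ν : Fin (d + 1)) (y' : Fin (d + 1) → ℤ),
        tadpole (coDressKBmAt (toSite r) Lc (KInvStep (d := d) Lc i))
          (vertexOfK (coDressKBmAt (toSite r) Lc (KInvStep (d := d) Lc j)) Lc (Φ j y) ν y' + Ψ j y ν y') = 0) ∧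
      -- (EVEN LAW) THE EVEN HALF OF THE W-LITERAL OBEYS THE EXACT BLOCK WARD IDENTITY (p2 §5 (b), in the junction's `½ • (W + sgnK∘trK∘W)` spelling)
      (∀ (j : ℕ) (y : Fin (d + 1) → ℤ) (ν : Fin (d + 1)) (y' : Fin (d + 1) → ℤ),
        divW (fun μ u ν' w => (1 / 2 : ℝ) •
            (WrecAt d Lc (toSite r) ((Lc : ℝ) ^ (d + 1)) (-((Lc : ℝ) ^ (d + 1) * (1 / 2) * (Lc : ℝ) ^ (d + 1))) cΛ cE₂ cB T vh₂S mixFF j μ u ν' w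
              + sgnK (trK (WrecAt d Lc (toSite r) ((Lc : ℝ) ^ (d + 1)) (-((Lc : ℝ) ^ (d + 1) * (1 / 2) * (Lc : ℝ) ^ (d + 1))) cΛ cE₂ cB T vh₂S mixFF j μ u ν' w)))) y ν y' =
          conjV (dM (coDressKBmAt (toSite r) Lc (KInvStep (d := d) Lc j)) Lc
            (SpureRecAt d Lc (toSite r) ((Lc : ℝ) ^ (d + 1)) (-((Lc : ℝ) ^ (d + 1) * (1 / 2) * (Lc : ℝ) ^ (d + 1))) cΛ j)
            (M1At d Lc (toSite r) cΛ j) ν y')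
          (diagK (((1 : ℝ) / 2) • ∑ v ∈ box (d + 1) Lc, legInd (toSite r) ((Lc : ℤ) • y + toSite v)))) ∧
      -- (ODD LAW) THE WARD-LOCUS RESIDUAL IS THE PURE-GAUGE SLICE OF THE ODD HALF (p2 §5 (c), in the junction's `½ • (W − sgnK∘trK∘W)` spelling)
      (∀ (j : ℕ) (y : Fin (d + 1) → ℤ) (ν : Fin (d + 1)) (y' : Fin (d + 1) → ℤ),
        divW (fun μ u ν' w => (1 / 2 : ℝ) •
            (WrecAt d Lc (toSite r) ((Lc : ℝ) ^ (d + 1)) (-((Lc : ℝ) ^ (d + 1) * (1 / 2) * (Lc : ℝ) ^ (d + 1))) cΛ cE₂ cB T vh₂S mixFF j μ u ν' w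
              - sgnK (trK (WrecAt d Lc (toSite r) ((Lc : ℝ) ^ (d + 1)) (-((Lc : ℝ) ^ (d + 1) * (1 / 2) * (Lc : ℝ) ^ (d + 1))) cΛ cE₂ cB T vh₂S mixFF j μ u ν' w)))) y ν y' =
          vertexOfK (coDressKBmAt (toSite r) Lc (KInvStep (d := d) Lc j)) Lc (Φ j y) ν y' + Ψ j y ν y') := by
  obtain ⟨Φ, Ψ, hΨ, hΦ0, hΦS, hcls, hres, hlaw⟩ :=
    exists_kernelLaws_vertexForm hLc hr cΛ cB hcE₂ T hB hmix hcls0 hclsS hWil hWil'' hBord0 hBord0'' hBordS hBordS'' hM₂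
  obtain ⟨hΨp, hΦp, -, htad⟩ := parityOdd_residual_tower hLc hr cΛ hRWp hRW''p hRBp hRB''p hRMp hΨ hΦ0 hΦS hcls hres
  obtain ⟨-, hev, hod⟩ := ward_law_parity_split hLc hr cΛ hΨp hΦp hlaw
  refine ⟨Φ, Ψ, hΨ, hΦ0, hΦS, hcls, hres, hlaw, hΨp, hΦp, htad, fun j y ν y' => ?_, fun j y ν y' => ?_⟩
  · have h := hev j y ν y'
    simp only [one_smul] at h
    exact h
  · have h := hod j y ν y'
    simp only [neg_one_smul, ← sub_eq_add_neg] at h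
    exact h


/-- NOT IN PRINT; OUR BOOKKEEPING.  **THE SAME AT THE WILSON TABLE OF RECORD `T_W := (8N²)⁻¹ • wsym22 N` (every `SU(N)`, `2 ≤ N`; generic `d`, in-block root): THE TWO
WILSON LETTERS DISCHARGED** — `hWil` ∕ `hWil''` are leaf-09 ∕ d1-leaf-06's `WilsonWardColourFree.hWil_wilson_TW_su ∕ hWil''_wilson_TW_su` with `RW = RW″ = 0` (their classes and
parities are then free: the zero family), so the END asks only an1's BORDER letters (both slots, every level; remainders `RB RB″` with classes and parities) and MIXED
letter (every level; `RM`), exactly as the D1 lane's `RowD1JointEnd` displays them, and returns the (Ψ) ∕ (Φ₀) `Φ 0 = ½ • (RB 0 + RB″ 0)` ∕ (Φ-STEP) ∕ classes ∕ (LAW) ∕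
(P-Ψ) ∕ (P-Φ) ∕ (TAD) ∕ (EVEN LAW) ∕ (ODD LAW) package for the W-literal `WrecAt d Lc ρ cE cVH cΛ cE₂ cB T_W vh₂S mixFF`. -/
theorem exists_kernelLaws_vertexForm_parity_TW_su (hLc : 1 ≤ Lc) {r : Fin (d + 1) → ℕ} (hr : r ∈ box (d + 1) Lc) (cΛ cB : ℝ) {cE₂ : ℝ}
    (hcE₂ : cE₂ = (Lc : ℝ) ^ (2 * (d + 1))) {N : ℕ} (hN : 2 ≤ N)
    {vh₂S : Fin (d + 1) → (Fin (d + 1) → ℤ) → Fin (d + 1) → (Fin (d + 1) → ℤ) → MKer (d + 1) (Fib d)}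
    (hB : ∃ C δ : ℝ, 0 < δ ∧ LocStencil₂ vh₂S C δ)
    {mixFF : Fin (d + 1) → (Fin (d + 1) → ℤ) → Fin (d + 1) → (Fin (d + 1) → ℤ) → MKer (d + 1) (Fib d)}
    (hmix : ∃ C δ : ℝ, 0 < δ ∧ LocStencilFM Lc mixFF C δ)
    {RB RB'' : ℕ → (Fin (d + 1) → ℤ) → Fin (d + 1) → (Fin (d + 1) → ℤ) → MKer (d + 1) (Fib d)} {RM : ℕ → (Fin (d + 1) → ℤ) → Fin (d + 1) → (Fin (d + 1) → ℤ) → MKer (d + 1) (Fib d)}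
    (hcls0 : ∃ C δ : ℝ, 0 < δ ∧ (∀ Y, LocStencil (RB 0 Y) C δ) ∧ (∀ Y, LocStencil (RB'' 0 Y) C δ) ∧ (∀ y, VertexFamily (RM 0 y) Lc C δ))
    (hclsS : ∀ j : ℕ, ∃ C δ : ℝ, 0 < δ ∧ (∀ Y, LocStencil (RB (j + 1) Y) C δ) ∧ (∀ Y, LocStencil (RB'' (j + 1) Y) C δ) ∧
      (∀ y, VertexFamily (RM (j + 1) y) Lc C δ))
    -- the three remaining letter-remainder ROW PARITIES (the Wilson letters are EXACT at `T_W`: `RW = RW″ = 0`)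
    (hRBp : ∀ j Y κ u, trK (RB j Y κ u) = -sgnK (RB j Y κ u)) (hRB''p : ∀ j Y κ u, trK (RB'' j Y κ u) = -sgnK (RB'' j Y κ u))
    (hRMp : ∀ j y ρ w, trK (RM j y ρ w) = -sgnK (RM j y ρ w))
    (hBord0 : ∀ (Y : Fin (d + 1) → ℤ) (κ' : Fin (d + 1)) (u' : Fin (d + 1) → ℤ),
      (stepScale d Lc 0 * (Lc : ℝ) ^ (d + 1))⁻¹ • ∑ v ∈ box (d + 1) Lc, divV (fun κ u => cB • vh₂S κ u κ' u') ((Lc : ℤ) • Y + toSite v) =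
        comp ((-((Lc : ℝ) ^ (d + 1) * (1 / 2) * (Lc : ℝ) ^ (d + 1))) • vhSAt (toSite r) d Lc rfl κ' u') (diagK (((1 : ℝ) / 2) • ∑ v ∈ box (d + 1) Lc, legInd (toSite r) ((Lc : ℤ) • Y + toSite v)))
          - comp (diagK (((1 : ℝ) / 2) • ∑ v ∈ box (d + 1) Lc, legInd (toSite r) ((Lc : ℤ) • Y + toSite v))) ((-((Lc : ℝ) ^ (d + 1) * (1 / 2) * (Lc : ℝ) ^ (d + 1))) • vhSAt (toSite r) d Lc rfl κ' u')
          + RB 0 Y κ' u')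
    (hBord0'' : ∀ (Y : Fin (d + 1) → ℤ) (κ : Fin (d + 1)) (u : Fin (d + 1) → ℤ),
      (stepScale d Lc 0 * (Lc : ℝ) ^ (d + 1))⁻¹ • ∑ v ∈ box (d + 1) Lc, divV (fun κ' u' => cB • vh₂S κ u κ' u') ((Lc : ℤ) • Y + toSite v) =
        comp ((-((Lc : ℝ) ^ (d + 1) * (1 / 2) * (Lc : ℝ) ^ (d + 1))) • vhSAt (toSite r) d Lc rfl κ u) (diagK (((1 : ℝ) / 2) • ∑ v ∈ box (d + 1) Lc, legInd (toSite r) ((Lc : ℤ) • Y + toSite v)))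
          - comp (diagK (((1 : ℝ) / 2) • ∑ v ∈ box (d + 1) Lc, legInd (toSite r) ((Lc : ℤ) • Y + toSite v))) ((-((Lc : ℝ) ^ (d + 1) * (1 / 2) * (Lc : ℝ) ^ (d + 1))) • vhSAt (toSite r) d Lc rfl κ u)
          + RB'' 0 Y κ u)
    (hBordS : ∀ (j : ℕ) (Y : Fin (d + 1) → ℤ) (κ' : Fin (d + 1)) (u' : Fin (d + 1) → ℤ),
      (stepScale d Lc (j + 1) * (Lc : ℝ) ^ (d + 1))⁻¹ •
          ∑ v ∈ box (d + 1) Lc, divV (fun κ u => (cB * wB2 d Lc (j + 1)) • vh₂S κ u κ' u') ((Lc : ℤ) • Y + toSite v) =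
        comp ((-((Lc : ℝ) ^ (d + 1) * (1 / 2) * (Lc : ℝ) ^ (d + 1)) * wVH d Lc (j + 1)) • vhSAt (toSite r) d Lc rfl κ' u') (diagK (((1 : ℝ) / 2) • ∑ v ∈ box (d + 1) Lc, legInd (toSite r) ((Lc : ℤ) • Y + toSite v)))
          - comp (diagK (((1 : ℝ) / 2) • ∑ v ∈ box (d + 1) Lc, legInd (toSite r) ((Lc : ℤ) • Y + toSite v))) ((-((Lc : ℝ) ^ (d + 1) * (1 / 2) * (Lc : ℝ) ^ (d + 1)) * wVH d Lc (j + 1)) • vhSAt (toSite r) d Lc rfl κ' u')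
          + RB (j + 1) Y κ' u')
    (hBordS'' : ∀ (j : ℕ) (Y : Fin (d + 1) → ℤ) (κ : Fin (d + 1)) (u : Fin (d + 1) → ℤ),
      (stepScale d Lc (j + 1) * (Lc : ℝ) ^ (d + 1))⁻¹ •
          ∑ v ∈ box (d + 1) Lc, divV (fun κ' u' => (cB * wB2 d Lc (j + 1)) • vh₂S κ u κ' u') ((Lc : ℤ) • Y + toSite v) =
        comp ((-((Lc : ℝ) ^ (d + 1) * (1 / 2) * (Lc : ℝ) ^ (d + 1)) * wVH d Lc (j + 1)) • vhSAt (toSite r) d Lc rfl κ u) (diagK (((1 : ℝ) / 2) • ∑ v ∈ box (d + 1) Lc, legInd (toSite r) ((Lc : ℤ) • Y + toSite v)))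
          - comp (diagK (((1 : ℝ) / 2) • ∑ v ∈ box (d + 1) Lc, legInd (toSite r) ((Lc : ℤ) • Y + toSite v))) ((-((Lc : ℝ) ^ (d + 1) * (1 / 2) * (Lc : ℝ) ^ (d + 1)) * wVH d Lc (j + 1)) • vhSAt (toSite r) d Lc rfl κ u)
          + RB'' (j + 1) Y κ u)
    (hM₂ : ∀ (j : ℕ) (y : Fin (d + 1) → ℤ) (ρ' : Fin (d + 1)) (w : Fin (d + 1) → ℤ),
      (stepScale d Lc j * (Lc : ℝ) ^ (d + 1))⁻¹ • ∑ v ∈ box (d + 1) Lc, divV (fun κ u => M2Of d Lc mixFF j κ u ρ' w) ((Lc : ℤ) • y + toSite v) =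
        comp (M1At d Lc (toSite r) cΛ j ρ' w) (diagK (((1 : ℝ) / 2) • ∑ v ∈ box (d + 1) Lc, legInd (toSite r) ((Lc : ℤ) • y + toSite v)))
          - comp (diagK (((1 : ℝ) / 2) • ∑ v ∈ box (d + 1) Lc, legInd (toSite r) ((Lc : ℤ) • y + toSite v))) (M1At d Lc (toSite r) cΛ j ρ' w)
          + RM j y ρ' w) :
    ∃ Φ Ψ : ℕ → (Fin (d + 1) → ℤ) → Fin (d + 1) → (Fin (d + 1) → ℤ) → MKer (d + 1) (Fib d),
      -- (Ψ) the vertex-free part: level-`j` FIRST-ORDER data and letters only (the chair's clause, verbatim)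
      (∀ (j : ℕ) (y : Fin (d + 1) → ℤ) (ν : Fin (d + 1)) (y' : Fin (d + 1) → ℤ), Ψ j y ν y' =
        vertexOfM (coDressKBmAt (toSite r) Lc (KInvStep (d := d) Lc j)) Lc (RM j y) ν y'
        + (1 / 2 : ℝ) • (dM (conjV (coDressKBmAt (toSite r) Lc (KInvStep (d := d) Lc j))
                (diagK (((1 : ℝ) / 2) • ∑ v ∈ box (d + 1) Lc, legInd (toSite r) ((Lc : ℤ) • y + toSite v)))) Lc
              (SpureRecAt d Lc (toSite r) ((Lc : ℝ) ^ (d + 1)) (-((Lc : ℝ) ^ (d + 1) * (1 / 2) * (Lc : ℝ) ^ (d + 1))) cΛ j)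
              (M1At d Lc (toSite r) cΛ j) ν y'
          - (stepScale d Lc j * (Lc : ℝ) ^ (d + 1))⁻¹ • (∑ κ, wsum (fun u => ∑' x₂, ∑ κ₂,
              comp (coDressKBmAt (toSite r) Lc (KInvStep (d := d) Lc j))
                (dM (coDressKBmAt (toSite r) Lc (KInvStep (d := d) Lc j)) Lc
                  (SpureRecAt d Lc (toSite r) ((Lc : ℝ) ^ (d + 1)) (-((Lc : ℝ) ^ (d + 1) * (1 / 2) * (Lc : ℝ) ^ (d + 1))) cΛ j)
                  (M1At d Lc (toSite r) cΛ j) ν y') u x₂ (Sum.inl κ) (Sum.inl κ₂) * gaugeWt Lc y κ₂ x₂)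
              (SpureRecAt d Lc (toSite r) ((Lc : ℝ) ^ (d + 1)) (-((Lc : ℝ) ^ (d + 1) * (1 / 2) * (Lc : ℝ) ^ (d + 1))) cΛ j κ)
            + ∑ ρ', cwsum Lc (fun w => ∑' x₂, ∑ κ₂,
              comp (coDressKBmAt (toSite r) Lc (KInvStep (d := d) Lc j))
                (dM (coDressKBmAt (toSite r) Lc (KInvStep (d := d) Lc j)) Lc
                  (SpureRecAt d Lc (toSite r) ((Lc : ℝ) ^ (d + 1)) (-((Lc : ℝ) ^ (d + 1) * (1 / 2) * (Lc : ℝ) ^ (d + 1))) cΛ j)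
                  (M1At d Lc (toSite r) cΛ j) ν y') ((Lc : ℤ) • w) x₂ (Sum.inr ρ') (Sum.inl κ₂) * gaugeWt Lc y κ₂ x₂)
              (M1At d Lc (toSite r) cΛ j ρ')))) ∧
      -- (Φ₀)
      (Φ 0 = fun y κ u => (1 / 2 : ℝ) • (RB 0 y κ u + RB'' 0 y κ u)) ∧
      -- (Φ-STEP)
      (∀ j : ℕ, Φ (j + 1) = fun Y κ' u' =>
        ∑ v ∈ box (d + 1) Lc, ((Lc : ℝ) ^ (d + 1) * wE d Lc (j + 1)) •
            e3OfK Lc (coDressKBmAt (toSite r) Lc (KInvStep (d := d) Lc j)) (Φ j ((Lc : ℤ) • Y + toSite v)) κ' u'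
          + ((-((Lc : ℝ) ^ (d + 1) * wE d Lc (j + 1))) • ∑ v ∈ box (d + 1) Lc,
                mmRead Lc (comp (comp (coDressKBmAt (toSite r) Lc (KInvStep (d := d) Lc j)) (Ψ j ((Lc : ℤ) • Y + toSite v) κ' u'))
                  (coDressKBmAt (toSite r) Lc (KInvStep (d := d) Lc j)))
            + (1 / 2 : ℝ) • (RB (j + 1) Y κ' u' + RB'' (j + 1) Y κ' u'))) ∧
      -- per-level classes (NO uniformity in `j`)
      (∀ j : ℕ, ∃ C δ : ℝ, 0 < δ ∧ ∀ y, LocStencil (Φ j y) C δ) ∧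
      (∀ j : ℕ, ∃ C δ : ℝ, 0 < δ ∧ ∀ y, VertexFamily (fun ν y' => vertexOfK (coDressKBmAt (toSite r) Lc (KInvStep (d := d) Lc j)) Lc (Φ j y) ν y' + Ψ j y ν y') Lc C δ) ∧
      -- (LAW)
      (∀ (j : ℕ) (y : Fin (d + 1) → ℤ) (ν : Fin (d + 1)) (y' : Fin (d + 1) → ℤ),
        divW (WrecAt d Lc (toSite r) ((Lc : ℝ) ^ (d + 1)) (-((Lc : ℝ) ^ (d + 1) * (1 / 2) * (Lc : ℝ) ^ (d + 1))) cΛ cE₂ cB ((8 * (N : ℝ) ^ 2)⁻¹ • wsym22 N) vh₂S mixFF j) y ν y' =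
          conjV (dM (coDressKBmAt (toSite r) Lc (KInvStep (d := d) Lc j)) Lc
            (SpureRecAt d Lc (toSite r) ((Lc : ℝ) ^ (d + 1)) (-((Lc : ℝ) ^ (d + 1) * (1 / 2) * (Lc : ℝ) ^ (d + 1))) cΛ j)
            (M1At d Lc (toSite r) cΛ j) ν y')
          (diagK (((1 : ℝ) / 2) • ∑ v ∈ box (d + 1) Lc, legInd (toSite r) ((Lc : ℤ) • y + toSite v)))
        + (vertexOfK (coDressKBmAt (toSite r) Lc (KInvStep (d := d) Lc j)) Lc (Φ j y) ν y' + Ψ j y ν y')) ∧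
      -- (P-Ψ) the first-order data are ROW-PARITY-ODD
      (∀ (j : ℕ) (y : Fin (d + 1) → ℤ) (ν : Fin (d + 1)) (y' : Fin (d + 1) → ℤ), trK (Ψ j y ν y') = -sgnK (Ψ j y ν y')) ∧
      -- (P-Φ) THE WARD-LOCUS RESIDUAL TOWER IS ROW-PARITY-ODD AT EVERY LEVEL
      (∀ (j : ℕ) (y : Fin (d + 1) → ℤ) (κ : Fin (d + 1)) (u : Fin (d + 1) → ℤ), trK (Φ j y κ u) = -sgnK (Φ j y κ u)) ∧
      -- (TAD) the LAW's residual is tadpole-null against every co-dressed step resolvent (the D1 consumer's (PAR) class; p2 §3 (d))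
      (∀ (i j : ℕ) (y : Fin (d + 1) → ℤ) (ν : Fin (d + 1)) (y' : Fin (d + 1) → ℤ),
        tadpole (coDressKBmAt (toSite r) Lc (KInvStep (d := d) Lc i))
          (vertexOfK (coDressKBmAt (toSite r) Lc (KInvStep (d := d) Lc j)) Lc (Φ j y) ν y' + Ψ j y ν y') = 0) ∧
      -- (EVEN LAW) THE EVEN HALF OF THE W-LITERAL OBEYS THE EXACT BLOCK WARD IDENTITY (p2 §5 (b), in the junction's `½ • (W + sgnK∘trK∘W)` spelling)
      (∀ (j : ℕ) (y : Fin (d + 1) → ℤ) (ν : Fin (d + 1)) (y' : Fin (d + 1) → ℤ),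
        divW (fun μ u ν' w => (1 / 2 : ℝ) •
            (WrecAt d Lc (toSite r) ((Lc : ℝ) ^ (d + 1)) (-((Lc : ℝ) ^ (d + 1) * (1 / 2) * (Lc : ℝ) ^ (d + 1))) cΛ cE₂ cB ((8 * (N : ℝ) ^ 2)⁻¹ • wsym22 N) vh₂S mixFF j μ u ν' w
              + sgnK (trK (WrecAt d Lc (toSite r) ((Lc : ℝ) ^ (d + 1)) (-((Lc : ℝ) ^ (d + 1) * (1 / 2) * (Lc : ℝ) ^ (d + 1))) cΛ cE₂ cB ((8 * (N : ℝ) ^ 2)⁻¹ • wsym22 N) vh₂S mixFF j μ u ν' w)))) y ν y' =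
          conjV (dM (coDressKBmAt (toSite r) Lc (KInvStep (d := d) Lc j)) Lc
            (SpureRecAt d Lc (toSite r) ((Lc : ℝ) ^ (d + 1)) (-((Lc : ℝ) ^ (d + 1) * (1 / 2) * (Lc : ℝ) ^ (d + 1))) cΛ j)
            (M1At d Lc (toSite r) cΛ j) ν y')
          (diagK (((1 : ℝ) / 2) • ∑ v ∈ box (d + 1) Lc, legInd (toSite r) ((Lc : ℤ) • y + toSite v)))) ∧
      -- (ODD LAW) THE WARD-LOCUS RESIDUAL IS THE PURE-GAUGE SLICE OF THE ODD HALF (p2 §5 (c), in the junction's `½ • (W − sgnK∘trK∘W)` spelling)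
      (∀ (j : ℕ) (y : Fin (d + 1) → ℤ) (ν : Fin (d + 1)) (y' : Fin (d + 1) → ℤ),
        divW (fun μ u ν' w => (1 / 2 : ℝ) •
            (WrecAt d Lc (toSite r) ((Lc : ℝ) ^ (d + 1)) (-((Lc : ℝ) ^ (d + 1) * (1 / 2) * (Lc : ℝ) ^ (d + 1))) cΛ cE₂ cB ((8 * (N : ℝ) ^ 2)⁻¹ • wsym22 N) vh₂S mixFF j μ u ν' w
              - sgnK (trK (WrecAt d Lc (toSite r) ((Lc : ℝ) ^ (d + 1)) (-((Lc : ℝ) ^ (d + 1) * (1 / 2) * (Lc : ℝ) ^ (d + 1))) cΛ cE₂ cB ((8 * (N : ℝ) ^ 2)⁻¹ • wsym22 N) vh₂S mixFF j μ u ν' w)))) y ν y' =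
          vertexOfK (coDressKBmAt (toSite r) Lc (KInvStep (d := d) Lc j)) Lc (Φ j y) ν y' + Ψ j y ν y') := by
  obtain ⟨C, δ, hδ, hRB0, hRB''0, hRM0⟩ := hcls0
  have hC : 0 ≤ C := (hRB0 0 0 0).nonneg (Sum.inl 0)
  have hz : ∀ Y : Fin (d + 1) → ℤ,
      LocStencil ((0 : (Fin (d + 1) → ℤ) → Fin (d + 1) → (Fin (d + 1) → ℤ) → MKer (d + 1) (Fib d)) Y) C δ := fun Y κ u x y a b => by
    simp only [Pi.zero_apply, abs_zero]
    positivity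
  have hzp : ∀ (Y : Fin (d + 1) → ℤ) (κ : Fin (d + 1)) (u : Fin (d + 1) → ℤ),
      trK ((0 : (Fin (d + 1) → ℤ) → Fin (d + 1) → (Fin (d + 1) → ℤ) → MKer (d + 1) (Fib d)) Y κ u)
        = -sgnK ((0 : (Fin (d + 1) → ℤ) → Fin (d + 1) → (Fin (d + 1) → ℤ) → MKer (d + 1) (Fib d)) Y κ u) := fun Y κ u => by
    simp only [Pi.zero_apply]
    exact parityOdd_zero
  obtain ⟨Φ, Ψ, hΨ, hΦ0, hrest⟩ := exists_kernelLaws_vertexForm_parity hLc hr cΛ cB hcE₂ ((8 * (N : ℝ) ^ 2)⁻¹ • wsym22 N) hB hmix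
    ⟨C, δ, hδ, hz, hz, hRB0, hRB''0, hRM0⟩ hclsS hzp hzp hRBp hRB''p hRMp (hWil_wilson_TW_su hN Lc r hcE₂) (hWil''_wilson_TW_su hN Lc r hcE₂)
    hBord0 hBord0'' hBordS hBordS'' hM₂
  refine ⟨Φ, Ψ, hΨ, ?_, hrest⟩
  rw [hΦ0]
  funext y κ u
  simp only [Pi.zero_apply, zero_add]

end Summit.QuantumFields.BalabanUV.Beta.GAN24.WSlotParityJunctionLetters
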